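import Mathlib
import HarnessLib

/-!
# Route `KLProgramme` — scalar QUOTIENT DIFFERENCES: `x̃/D̃ − x/D`, `x̃ỹ/D̃² − xy/D²`, `x̃ỹ²/D̃³ − xy²/D³` for `D, D̃ ≥ ρ₀ > 0`
# (the real-number half of the two-frame polar-Jacobian differences)

Cell `gate-hubbard-kl`, seat hubbard-kl-k3c3-p3 (g7; row «implicit-function / monotonicity route for μ(n)»); helper for the engine-flow child
`KLRegimeEngineV17F2` (stmt-HubbardSuperconductivity-20437), stub (C) `stub_twoLeg_curvature`, plan (R47r) «window-specific certified Jacobian-jet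
bundle», c4a-1's Lean endpoint C4A-PLAN §15.3 (M-alt) `‖∂ⁱJ_K‖ ≤ jacCertG i + jacPert i` (`i ≤ 2`).  The polar Jacobian `J = u/D` and its first
two angular derivatives are the quotient-rule expressions `u/D`, `u′/D − uD′/D²`, `u″/D − uD″/D² − 2u′D′/D² + 2uD′²/D³` (c4a-1's
`…C4aJacobianPolarJets`); comparing them for two curves needs exactly the three scalar estimates of this module, each LINEAR in the
differences `|x̃ − x| ≤ w`, `|ỹ − y| ≤ gy`, `|D̃ − D| ≤ g`:

* `abs_inv_sub_inv_le` (`g/ρ₀²`), `abs_inv_sq_sub_inv_sq_le` (`2g/ρ₀³`), `abs_inv_cube_sub_inv_cube_le` (`3g/ρ₀⁴`);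
* `abs_div_sub_div_le'` (`w/ρ₀ + X·g/ρ₀²`), `abs_mul_div_sq_sub_le` (`(wY + X·gy)/ρ₀² + 2XY·g/ρ₀³`),
  `abs_mul_sq_div_cube_sub_le` (`(wY² + 2XY·gy)/ρ₀³ + 3XY²·g/ρ₀⁴`).

Consumed by `…PerturbedFermiCurveTwoFrameJacobian`.  Pure real algebra; nothing about the Hubbard model. [folklore]
-/

noncomputable section

namespace Summit.HubbardSuperconductivity.HubbardSuperconductivity.Theorems.PerturbedFermiCurve

set_option linter.dupNamespace false -- summit = problem name (single-conjunct summit), D-0017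

open Real Set

/-! ## §1 Scalar quotient differences -/

section Scalar

variable {ρ₀ D D' : ℝ} (hρ0 : 0 < ρ₀) (hρ : ρ₀ ≤ D) (hρ' : ρ₀ ≤ D') {g : ℝ}
include hρ0 hρ hρ'

/-- `|1/D̃ − 1/D| ≤ g/ρ₀²`. -/
theorem abs_inv_sub_inv_le (hg : |D' - D| ≤ g) : |1 / D' - 1 / D| ≤ g / ρ₀ ^ 2 := by
  have hD : 0 < D := hρ0.trans_le hρ
  have hD' : 0 < D' := hρ0.trans_le hρ'
  have key : 1 / D' - 1 / D = (D - D') / (D * D') := by field_simp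
  rw [key, abs_div, abs_mul, abs_of_pos hD, abs_of_pos hD', abs_sub_comm]
  exact div_le_div₀ ((abs_nonneg _).trans hg) hg (pow_pos hρ0 2) (by nlinarith [mul_le_mul hρ hρ' hρ0.le hD.le])

/-- `|1/D̃² − 1/D²| ≤ 2g/ρ₀³`. -/
theorem abs_inv_sq_sub_inv_sq_le (hg : |D' - D| ≤ g) : |1 / D' ^ 2 - 1 / D ^ 2| ≤ 2 * g / ρ₀ ^ 3 := by
  have hD : 0 < D := hρ0.trans_le hρ
  have hD' : 0 < D' := hρ0.trans_le hρ'
  have hg0 : 0 ≤ g := (abs_nonneg _).trans hg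
  have key : 1 / D' ^ 2 - 1 / D ^ 2 = (D - D') * (1 / (D * D' ^ 2) + 1 / (D ^ 2 * D')) := by field_simp; ring
  rw [key, abs_mul, abs_sub_comm]
  have h1 : 1 / (D * D' ^ 2) ≤ 1 / ρ₀ ^ 3 :=
    one_div_le_one_div_of_le (pow_pos hρ0 3) (by nlinarith [mul_le_mul hρ' hρ' hρ0.le hD'.le, mul_pos hD hD'])
  have h2 : 1 / (D ^ 2 * D') ≤ 1 / ρ₀ ^ 3 :=
    one_div_le_one_div_of_le (pow_pos hρ0 3) (by nlinarith [mul_le_mul hρ hρ hρ0.le hD.le, mul_pos hD hD'])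
  have hpos : 0 ≤ 1 / (D * D' ^ 2) + 1 / (D ^ 2 * D') := by positivity
  rw [abs_of_nonneg hpos]
  calc |D' - D| * (1 / (D * D' ^ 2) + 1 / (D ^ 2 * D')) ≤ g * (1 / ρ₀ ^ 3 + 1 / ρ₀ ^ 3) :=
        mul_le_mul hg (add_le_add h1 h2) hpos hg0
    _ = 2 * g / ρ₀ ^ 3 := by ring

/-- `|1/D̃³ − 1/D³| ≤ 3g/ρ₀⁴`. -/
theorem abs_inv_cube_sub_inv_cube_le (hg : |D' - D| ≤ g) : |1 / D' ^ 3 - 1 / D ^ 3| ≤ 3 * g / ρ₀ ^ 4 := by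
  have hD : 0 < D := hρ0.trans_le hρ
  have hD' : 0 < D' := hρ0.trans_le hρ'
  have hg0 : 0 ≤ g := (abs_nonneg _).trans hg
  have key : 1 / D' ^ 3 - 1 / D ^ 3 = (D - D') * (1 / (D * D' ^ 3) + 1 / (D ^ 2 * D' ^ 2) + 1 / (D ^ 3 * D')) := by
    field_simp; ring
  rw [key, abs_mul, abs_sub_comm]
  have hDD : ρ₀ * ρ₀ ≤ D * D' := mul_le_mul hρ hρ' hρ0.le hD.le
  have h1 : 1 / (D * D' ^ 3) ≤ 1 / ρ₀ ^ 4 :=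
    one_div_le_one_div_of_le (pow_pos hρ0 4) (by nlinarith [mul_le_mul hρ' hρ' hρ0.le hD'.le, mul_pos hD hD', pow_pos hρ0 2])
  have h2 : 1 / (D ^ 2 * D' ^ 2) ≤ 1 / ρ₀ ^ 4 :=
    one_div_le_one_div_of_le (pow_pos hρ0 4) (by nlinarith [mul_pos hD hD', pow_pos hρ0 2])
  have h3 : 1 / (D ^ 3 * D') ≤ 1 / ρ₀ ^ 4 :=
    one_div_le_one_div_of_le (pow_pos hρ0 4) (by nlinarith [mul_le_mul hρ hρ hρ0.le hD.le, mul_pos hD hD', pow_pos hρ0 2])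
  have hpos : 0 ≤ 1 / (D * D' ^ 3) + 1 / (D ^ 2 * D' ^ 2) + 1 / (D ^ 3 * D') := by positivity
  rw [abs_of_nonneg hpos]
  calc |D' - D| * (1 / (D * D' ^ 3) + 1 / (D ^ 2 * D' ^ 2) + 1 / (D ^ 3 * D')) ≤ g * (1 / ρ₀ ^ 4 + 1 / ρ₀ ^ 4 + 1 / ρ₀ ^ 4) :=
        mul_le_mul hg (add_le_add (add_le_add h1 h2) h3) hpos hg0
    _ = 3 * g / ρ₀ ^ 4 := by ring

/-- **`|x̃/D̃ − x/D| ≤ w/ρ₀ + X·g/ρ₀²`** (`|x̃ − x| ≤ w`, `|x| ≤ X`). -/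
theorem abs_div_sub_div_le' (hg : |D' - D| ≤ g) {x x' w X : ℝ} (hw : |x' - x| ≤ w) (hX : |x| ≤ X) :
    |x' / D' - x / D| ≤ w / ρ₀ + X * g / ρ₀ ^ 2 := by
  have hD : 0 < D := hρ0.trans_le hρ
  have hD' : 0 < D' := hρ0.trans_le hρ'
  have key : x' / D' - x / D = (x' - x) * (1 / D') + x * (1 / D' - 1 / D) := by field_simp; ring
  rw [key]
  have h1 : |(x' - x) * (1 / D')| ≤ w / ρ₀ := by
    rw [abs_mul, abs_of_pos (by positivity : (0:ℝ) < 1 / D'), ← div_eq_mul_one_div]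
    exact div_le_div₀ ((abs_nonneg _).trans hw) hw hρ0 hρ'
  have h2 : |x * (1 / D' - 1 / D)| ≤ X * g / ρ₀ ^ 2 := by
    rw [abs_mul, mul_div_assoc]
    exact mul_le_mul hX (abs_inv_sub_inv_le hρ0 hρ hρ' hg) (abs_nonneg _) ((abs_nonneg _).trans hX)
  exact (abs_add_le _ _).trans (add_le_add h1 h2)

/-- **`|x̃ỹ/D̃² − xy/D²| ≤ (w·Y + X·gy)/ρ₀² + 2·X·Y·g/ρ₀³`** (`|x̃ − x| ≤ w`, `|x| ≤ X`, `|y|, |ỹ| ≤ Y`, `|ỹ − y| ≤ gy`). -/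
theorem abs_mul_div_sq_sub_le (hg : |D' - D| ≤ g) {x x' y y' w gy X Y : ℝ} (hw : |x' - x| ≤ w) (hX : |x| ≤ X)
    (hY : |y| ≤ Y) (hY' : |y'| ≤ Y) (hgy : |y' - y| ≤ gy) :
    |x' * y' / D' ^ 2 - x * y / D ^ 2| ≤ (w * Y + X * gy) / ρ₀ ^ 2 + 2 * (X * Y) * g / ρ₀ ^ 3 := by
  have hD : 0 < D := hρ0.trans_le hρ
  have hD' : 0 < D' := hρ0.trans_le hρ'
  have hX0 : 0 ≤ X := (abs_nonneg _).trans hX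
  have hY0 : 0 ≤ Y := (abs_nonneg _).trans hY
  have key : x' * y' / D' ^ 2 - x * y / D ^ 2 = (x' * y' - x * y) * (1 / D' ^ 2) + x * y * (1 / D' ^ 2 - 1 / D ^ 2) := by
    field_simp; ring
  rw [key]
  have hprod : |x' * y' - x * y| ≤ w * Y + X * gy := by
    have e1 : x' * y' - x * y = (x' - x) * y' + x * (y' - y) := by ring
    rw [e1]
    refine (abs_add_le _ _).trans (add_le_add ?_ ?_)
    · rw [abs_mul]; exact mul_le_mul hw hY' (abs_nonneg _) ((abs_nonneg _).trans hw)
    · rw [abs_mul]; exact mul_le_mul hX hgy (abs_nonneg _) hX0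
  have h1 : |(x' * y' - x * y) * (1 / D' ^ 2)| ≤ (w * Y + X * gy) / ρ₀ ^ 2 := by
    rw [abs_mul, abs_of_pos (by positivity : (0:ℝ) < 1 / D' ^ 2), ← div_eq_mul_one_div]
    exact div_le_div₀ ((abs_nonneg _).trans hprod) hprod (pow_pos hρ0 2) (pow_le_pow_left₀ hρ0.le hρ' 2)
  have h2 : |x * y * (1 / D' ^ 2 - 1 / D ^ 2)| ≤ 2 * (X * Y) * g / ρ₀ ^ 3 := by
    rw [abs_mul, abs_mul]
    have hxy : |x| * |y| ≤ X * Y := mul_le_mul hX hY (abs_nonneg _) hX0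
    calc |x| * |y| * |1 / D' ^ 2 - 1 / D ^ 2| ≤ X * Y * (2 * g / ρ₀ ^ 3) :=
          mul_le_mul hxy (abs_inv_sq_sub_inv_sq_le hρ0 hρ hρ' hg) (abs_nonneg _) (mul_nonneg hX0 hY0)
      _ = 2 * (X * Y) * g / ρ₀ ^ 3 := by ring
  exact (abs_add_le _ _).trans (add_le_add h1 h2)

/-- **`|x̃ỹ²/D̃³ − xy²/D³| ≤ (w·Y² + 2·X·Y·gy)/ρ₀³ + 3·X·Y²·g/ρ₀⁴`**. -/
theorem abs_mul_sq_div_cube_sub_le (hg : |D' - D| ≤ g) {x x' y y' w gy X Y : ℝ} (hw : |x' - x| ≤ w) (hX : |x| ≤ X)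
    (hY : |y| ≤ Y) (hY' : |y'| ≤ Y) (hgy : |y' - y| ≤ gy) :
    |x' * y' ^ 2 / D' ^ 3 - x * y ^ 2 / D ^ 3| ≤ (w * Y ^ 2 + 2 * (X * Y) * gy) / ρ₀ ^ 3 + 3 * (X * Y ^ 2) * g / ρ₀ ^ 4 := by
  have hD : 0 < D := hρ0.trans_le hρ
  have hD' : 0 < D' := hρ0.trans_le hρ'
  have hX0 : 0 ≤ X := (abs_nonneg _).trans hX
  have hY0 : 0 ≤ Y := (abs_nonneg _).trans hY
  have hgy0 : 0 ≤ gy := (abs_nonneg _).trans hgy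
  have key : x' * y' ^ 2 / D' ^ 3 - x * y ^ 2 / D ^ 3 =
      (x' * y' ^ 2 - x * y ^ 2) * (1 / D' ^ 3) + x * y ^ 2 * (1 / D' ^ 3 - 1 / D ^ 3) := by
    field_simp; ring
  rw [key]
  have hprod : |x' * y' ^ 2 - x * y ^ 2| ≤ w * Y ^ 2 + 2 * (X * Y) * gy := by
    have e1 : x' * y' ^ 2 - x * y ^ 2 = (x' - x) * y' ^ 2 + x * ((y' - y) * (y' + y)) := by ring
    rw [e1]
    refine (abs_add_le _ _).trans (add_le_add ?_ ?_)
    · rw [abs_mul, abs_pow]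
      exact mul_le_mul hw (pow_le_pow_left₀ (abs_nonneg _) hY' 2) (by positivity) ((abs_nonneg _).trans hw)
    · rw [abs_mul, abs_mul]
      have hsum : |y' + y| ≤ 2 * Y := (abs_add_le _ _).trans (by linarith)
      calc |x| * (|y' - y| * |y' + y|) ≤ X * (gy * (2 * Y)) :=
            mul_le_mul hX (mul_le_mul hgy hsum (abs_nonneg _) hgy0) (by positivity) hX0
        _ = 2 * (X * Y) * gy := by ring
  have h1 : |(x' * y' ^ 2 - x * y ^ 2) * (1 / D' ^ 3)| ≤ (w * Y ^ 2 + 2 * (X * Y) * gy) / ρ₀ ^ 3 := by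
    rw [abs_mul, abs_of_pos (by positivity : (0:ℝ) < 1 / D' ^ 3), ← div_eq_mul_one_div]
    exact div_le_div₀ ((abs_nonneg _).trans hprod) hprod (pow_pos hρ0 3) (pow_le_pow_left₀ hρ0.le hρ' 3)
  have h2 : |x * y ^ 2 * (1 / D' ^ 3 - 1 / D ^ 3)| ≤ 3 * (X * Y ^ 2) * g / ρ₀ ^ 4 := by
    rw [abs_mul, abs_mul, abs_pow]
    have hxy : |x| * |y| ^ 2 ≤ X * Y ^ 2 := mul_le_mul hX (pow_le_pow_left₀ (abs_nonneg _) hY 2) (by positivity) hX0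
    calc |x| * |y| ^ 2 * |1 / D' ^ 3 - 1 / D ^ 3| ≤ X * Y ^ 2 * (3 * g / ρ₀ ^ 4) :=
          mul_le_mul hxy (abs_inv_cube_sub_inv_cube_le hρ0 hρ hρ' hg) (abs_nonneg _) (by positivity)
      _ = 3 * (X * Y ^ 2) * g / ρ₀ ^ 4 := by ring
  exact (abs_add_le _ _).trans (add_le_add h1 h2)

end Scalar


end Summit.HubbardSuperconductivity.HubbardSuperconductivity.Theorems.PerturbedFermiCurve

end
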